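import Mathlib
import Summits.MatrixMultiplication.MatrixMultiplication.Theses.MatrixPointInterpolation
import Summits.MatrixMultiplication.MatrixMultiplication.Theorems.MatrixPointInterpolationWindowedKaplanskyCapelli

/-!
# Crux `TightWindows` (stmt-MatrixMultiplication-18939), line `shirshov-split` — stub
# `stub_fibreDensity` (fibre density, uniform in the point size)

Registered stub `stub_fibreDensity` of the skeleton of line `shirshov-split`.  Let the pair
`A : Fin 2 → M_n(ℂ)` generate `M_n` in degree `d` (`V_d = M_n`, `V_j = Masquerade.wordSpan A j`) and
satisfy every two-letter identity of `M_{K+1}(ℂ)` supported in degree `≤ 2d`, and suppose that SOME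
`Y₀ ∈ V_L` has `1, Y₀, …, Y₀^{K+1}` linearly independent.  Then for EVERY `Y ∈ V_L` all fibre sums
`R_p = Masquerade.capRest K Y Z' p` of the Cayley–Hamilton–Capelli polynomial vanish, for
`Z' i ∈ V_{e i}` with (unequal) slot budget `L(K+1)(K+2)/2 + d + ∑ e i ≤ 2d`.

Proof (a pencil argument over `ℂ[X]`, no exceptional sets).

* **Window on the pencil** (`Masquerade.capPow_eq_zero_of_window`, `Masquerade.capPow_succ_cons`).
  For every `u ∈ ℂ` the element `Y + u • Y₀ ∈ V_L` satisfies
  `P_{K+1}(Y + u•Y₀; M, Z') = ∑_p (Y + u•Y₀)^p · M · R_p(Y + u•Y₀, Z') = 0` for every `M ∈ M_n = V_d`.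
* **Polynomial identity.**  Put `𝕐 = Y + X • Y₀ ∈ M_n(ℂ[X])`.  By naturality of `capPow` under the
  entrywise evaluation `ℂ[X] → ℂ` at `u` (`Masquerade.map_capPow`), the matrix
  `P_{K+1}(𝕐; M, Z') ∈ M_n(ℂ[X])` vanishes at every `u ∈ ℂ`, hence is zero (`Polynomial.funext`):
  `∑_p 𝕐^p · M · R_p(𝕐, Z') = 0` in `M_n(ℂ[X])` for every constant matrix `M`, in particular for the
  matrix units.
* **Generic independence** (`linearIndependent_pencil_pow`).  The powers `𝕐^0, …, 𝕐^{K+1}` are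
  linearly independent over `ℂ[X]`: the entries of `𝕐^j` have degree `≤ j` with `X^j`-coefficient
  `Y₀^j` (`natDegree_pencil_pow`), so the top-degree coefficient of a nontrivial `ℂ[X]`-relation is a
  nontrivial `ℂ`-relation among the `Y₀^j`.
* **Tensor separation over `ℂ[X]`** (`eq_zero_of_sum_mul_single_mul_eq_zero`, the coordinate form
  of `M_n ⊗ M_nᵒᵖ ≅ End M_n`): hence `R_p(𝕐, Z') = 0` in `M_n(ℂ[X])`, and evaluating at `u = 0`
  (`map_capRest`) gives `R_p(Y, Z') = 0`.
-/

set_option linter.dupNamespace false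
-- `MatrixMultiplication.MatrixMultiplication` is the summit/sub-problem path (D-0017)

namespace Summit.MatrixMultiplication.MatrixMultiplication.Theorems.TightWindows

open scoped BigOperators
open Summit.MatrixMultiplication.MatrixMultiplication.Theorems.Masquerade Polynomial

/-! ### Naturality of the fibre sums and tensor separation over a commutative ring -/

/-- Ring homomorphisms commute with the fibre sums `capRest`. [folklore] -/
theorem map_capRest {R S F : Type*} [Ring R] [Ring S] [FunLike F R S] [RingHomClass F R S] (f : F)
    (K : ℕ) (y : R) (z' : Fin K → R) (p : Fin (K + 2)) :
    f (capRest K y z' p) = capRest K (f y) (f ∘ z') p := by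
  simp only [capRest, map_sum]
  refine Finset.sum_congr rfl fun σ _ => ?_
  rw [Units.smul_def, Units.smul_def, map_zsmul]
  congr 1
  simp only [capTail, map_mul, map_pow, map_list_prod, List.map_ofFn]
  congr 2
  exact congrArg List.ofFn (funext fun i => by simp)

/-- Entry formula for `P E_{st} Q` over a commutative ring. [folklore] -/
theorem sandwich_single_apply {R : Type*} [CommRing R] {n : ℕ} (P Q : Matrix (Fin n) (Fin n) R)
    (s t i l : Fin n) : (P * Matrix.single s t (1 : R) * Q) i l = P i s * Q t l := by
  rw [Matrix.single_eq_single_vecMulVec_single, Matrix.mul_vecMulVec, Matrix.vecMulVec_mul,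
    Matrix.vecMulVec_apply, Matrix.mulVec_single_one, Matrix.single_one_vecMul]
  rfl

/-- **Tensor separation over a commutative ring.**  If `P_0, …, P_{m-1} ∈ M_n(R)` are linearly
independent over `R` and `∑_i P_i E_{st} Q_i = 0` for every matrix unit `E_{st}`, then every `Q_i = 0`
(`M_n ⊗ M_nᵒᵖ ≅ End M_n`, in coordinates). [folklore] -/
theorem eq_zero_of_sum_mul_single_mul_eq_zero {R : Type*} [CommRing R] {n m : ℕ}
    {P : Fin m → Matrix (Fin n) (Fin n) R} (hP : LinearIndependent R P)
    {Q : Fin m → Matrix (Fin n) (Fin n) R}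
    (h : ∀ s t : Fin n, ∑ i, P i * Matrix.single s t (1 : R) * Q i = 0) (i : Fin m) : Q i = 0 := by
  ext t u
  have key : ∀ r s : Fin n, ∑ i, P i r s * Q i t u = 0 := by
    intro r s
    have := congrFun (congrFun (h s t) r) u
    simpa [Matrix.sum_apply, sandwich_single_apply] using this
  have hcomb : ∑ i, Q i t u • P i = 0 := by
    ext r s
    simp only [Matrix.sum_apply, Matrix.smul_apply, smul_eq_mul, Matrix.zero_apply]
    simpa [mul_comm] using key r s
  exact Fintype.linearIndependent_iff.1 hP _ hcomb i

/-! ### The pencil `Y + X • Y₀` over `ℂ[X]` -/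

/-- Evaluating a constant matrix (entries in `C ℂ ⊆ ℂ[X]`) at `u` returns the matrix. [folklore] -/
theorem eval_map_C {n : ℕ} (Z : Matrix (Fin n) (Fin n) ℂ) (u : ℂ) :
    (evalRingHom u).mapMatrix (Z.map C) = Z := by
  ext i j
  simp

/-- Evaluating the pencil `Y + X • Y₀ ∈ M_n(ℂ[X])` at `u` gives `Y + u • Y₀`. [folklore] -/
theorem eval_pencil {n : ℕ} (Y Y₀ : Matrix (Fin n) (Fin n) ℂ) (u : ℂ) :
    (evalRingHom u).mapMatrix (Y.map C + (X : ℂ[X]) • Y₀.map C) = Y + u • Y₀ := by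
  ext i j
  simpa using mul_comm _ _

/-- The entries of the pencil: `C (Y a b) + X · C (Y₀ a b)`. [folklore] -/
theorem pencil_apply {n : ℕ} (Y Y₀ : Matrix (Fin n) (Fin n) ℂ) (a b : Fin n) :
    (Y.map C + (X : ℂ[X]) • Y₀.map C) a b = C (Y a b) + X * C (Y₀ a b) := by
  simp

/-- The entries of the pencil have degree `≤ 1` and `X`-coefficient `Y₀`. [folklore] -/
theorem natDegree_pencil_apply {n : ℕ} (Y Y₀ : Matrix (Fin n) (Fin n) ℂ) (a b : Fin n) :
    ((Y.map C + (X : ℂ[X]) • Y₀.map C) a b).natDegree ≤ 1 ∧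
      ((Y.map C + (X : ℂ[X]) • Y₀.map C) a b).coeff 1 = Y₀ a b := by
  rw [pencil_apply]
  refine ⟨natDegree_add_le_of_degree_le ((natDegree_C _).trans_le zero_le_one)
    (natDegree_mul_le.trans ?_), by simp⟩
  rw [natDegree_C, add_zero]
  exact natDegree_X_le

/-- The entries of the `j`-th power of the pencil `Y + X • Y₀` are polynomials of degree `≤ j`
whose `X^j`-coefficient is the corresponding entry of `Y₀ ^ j`. [folklore] -/
theorem natDegree_pencil_pow {n : ℕ} (Y Y₀ : Matrix (Fin n) (Fin n) ℂ) :
    ∀ (j : ℕ) (a b : Fin n), (((Y.map C + (X : ℂ[X]) • Y₀.map C) ^ j) a b).natDegree ≤ j ∧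
      (((Y.map C + (X : ℂ[X]) • Y₀.map C) ^ j) a b).coeff j = (Y₀ ^ j) a b
  | 0, a, b => by
    simp only [pow_zero, Matrix.one_apply]
    split_ifs <;> simp
  | j + 1, a, b => by
    rw [pow_succ, pow_succ, Matrix.mul_apply, Matrix.mul_apply]
    refine ⟨natDegree_sum_le_of_forall_le _ _ fun c _ => natDegree_mul_le.trans
      (Nat.add_le_add (natDegree_pencil_pow Y Y₀ j a c).1 (natDegree_pencil_apply Y Y₀ c b).1), ?_⟩
    rw [finsetSum_coeff]
    refine Finset.sum_congr rfl fun c _ => ?_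
    rw [coeff_mul_add_eq_of_natDegree_le (natDegree_pencil_pow Y Y₀ j a c).1
      (natDegree_pencil_apply Y Y₀ c b).1, (natDegree_pencil_pow Y Y₀ j a c).2,
      (natDegree_pencil_apply Y Y₀ c b).2]

/-- **Generic independence.**  If `1, Y₀, …, Y₀^{m-1}` are linearly independent over `ℂ`, then the
powers of the pencil `Y + X • Y₀` are linearly independent over `ℂ[X]` (compare top-degree
coefficients of a relation). [folklore] -/
theorem linearIndependent_pencil_pow {n m : ℕ} (Y Y₀ : Matrix (Fin n) (Fin n) ℂ)
    (hind : LinearIndependent ℂ (fun j : Fin m => Y₀ ^ (j : ℕ))) :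
    LinearIndependent ℂ[X] (fun j : Fin m => (Y.map C + (X : ℂ[X]) • Y₀.map C) ^ (j : ℕ)) := by
  classical
  rw [Fintype.linearIndependent_iff]
  intro c hc
  by_contra hne
  obtain ⟨i, hi⟩ := not_forall.1 hne
  obtain ⟨j₀, hj₀, hmax⟩ := Finset.exists_max_image (Finset.univ.filter fun j : Fin m => c j ≠ 0)
    (fun j => (c j).natDegree + (j : ℕ)) ⟨i, by simpa using hi⟩
  have hcj₀ : c j₀ ≠ 0 := by simpa using hj₀
  -- the top-degree coefficient of the relation is a relation among the powers of `Y₀`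
  have hγ : ∑ j : Fin m, (if (c j).natDegree + (j : ℕ) = (c j₀).natDegree + (j₀ : ℕ)
      then (c j).leadingCoeff else 0) • Y₀ ^ (j : ℕ) = 0 := by
    ext a b
    have h := congrArg (fun M : Matrix (Fin n) (Fin n) ℂ[X] =>
      (M a b).coeff ((c j₀).natDegree + (j₀ : ℕ))) hc
    simp only [Matrix.sum_apply, Matrix.smul_apply, smul_eq_mul, Matrix.zero_apply, coeff_zero,
      finsetSum_coeff] at h
    rw [Matrix.sum_apply, Matrix.zero_apply]
    refine Eq.trans (Finset.sum_congr rfl fun j _ => ?_) h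
    rw [Matrix.smul_apply, smul_eq_mul]
    by_cases hcj : c j = 0
    · simp [hcj]
    · rcases (hmax j (by simpa using hcj)).eq_or_lt with heq | hlt
      · rw [if_pos heq, ← heq, coeff_mul_add_eq_of_natDegree_le le_rfl
          (natDegree_pencil_pow Y Y₀ j a b).1, (natDegree_pencil_pow Y Y₀ j a b).2]
        rfl
      · rw [if_neg hlt.ne, zero_mul, eq_comm]
        exact coeff_eq_zero_of_natDegree_lt ((natDegree_mul_le.trans
          (Nat.add_le_add_left (natDegree_pencil_pow Y Y₀ j a b).1 _)).trans_lt hlt)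
  have := Fintype.linearIndependent_iff.1 hind _ hγ j₀
  rw [if_pos rfl, leadingCoeff_eq_zero] at this
  exact hcj₀ this

/-! ### Fibre density -/

/-- **Fibre sums along a pencil.**  If `1, Y₀, …, Y₀^{K+1}` are linearly independent and the
Cayley–Hamilton–Capelli polynomial `P_{K+1}(Y + u•Y₀; M, Z')` vanishes for every `u ∈ ℂ` and every
full first slot `M ∈ M_n(ℂ)`, then all fibre sums `R_p(Y, Z')` vanish. [folklore] -/
theorem capRest_eq_zero_of_pencil {n K : ℕ} {Y Y₀ : Matrix (Fin n) (Fin n) ℂ}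
    {Z' : Fin K → Matrix (Fin n) (Fin n) ℂ}
    (hind : LinearIndependent ℂ (fun j : Fin (K + 2) => Y₀ ^ (j : ℕ)))
    (hwin : ∀ (u : ℂ) (M : Matrix (Fin n) (Fin n) ℂ),
      capPow (K + 1) (Y + u • Y₀) (Fin.cons M Z') = 0)
    (p : Fin (K + 2)) : capRest K Y Z' p = 0 := by
  -- the polynomial identity on the pencil
  have hpoly : ∀ M : Matrix (Fin n) (Fin n) ℂ, capPow (K + 1) (Y.map C + (X : ℂ[X]) • Y₀.map C)
      (Fin.cons (M.map C) fun i => (Z' i).map C) = 0 := by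
    intro M
    have hev : ∀ u : ℂ, (evalRingHom u).mapMatrix (capPow (K + 1)
        (Y.map C + (X : ℂ[X]) • Y₀.map C) (Fin.cons (M.map C) fun i => (Z' i).map C)) = 0 := by
      intro u
      rw [map_capPow, eval_pencil]
      have hcons : ((evalRingHom u).mapMatrix ∘ (Fin.cons (M.map C) fun i => (Z' i).map C) :
          Fin (K + 1) → Matrix (Fin n) (Fin n) ℂ) = Fin.cons M Z' := by
        refine funext (Fin.cases ?_ fun i => ?_)
        · simp only [Function.comp_apply, Fin.cons_zero, eval_map_C]
        · simp only [Function.comp_apply, Fin.cons_succ, eval_map_C]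
      rw [hcons]
      exact hwin u M
    refine Matrix.ext fun a b => Polynomial.funext fun u => ?_
    have := congrFun (congrFun (hev u) a) b
    simpa using this
  -- expand along the first slot at the matrix units and separate
  have hsep : ∀ s t : Fin n, ∑ q : Fin (K + 2), (Y.map C + (X : ℂ[X]) • Y₀.map C) ^ (q : ℕ) *
      Matrix.single s t (1 : ℂ[X]) *
      capRest K (Y.map C + (X : ℂ[X]) • Y₀.map C) (fun i => (Z' i).map C) q = 0 := by
    intro s t
    have := hpoly (Matrix.single s t 1)
    rwa [Matrix.map_single, map_one, capPow_succ_cons] at this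
  have hR := eq_zero_of_sum_mul_single_mul_eq_zero (linearIndependent_pencil_pow Y Y₀ hind) hsep p
  -- evaluate at `u = 0`
  have h0 := congrArg (evalRingHom (0 : ℂ)).mapMatrix hR
  rw [map_capRest, eval_pencil, zero_smul, add_zero, map_zero] at h0
  have hZ : ((evalRingHom (0 : ℂ)).mapMatrix ∘ fun i => (Z' i).map C) = Z' :=
    funext fun i => eval_map_C (Z' i) 0
  rwa [hZ] at h0

/-- **Fibre density** (registered stub `stub_fibreDensity`, uniform in the point size `K + 1`).  Let
`A` generate `M_n` in degree `d` and satisfy every two-letter identity of `M_{K+1}` of degree `≤ 2d`,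
and suppose some `Y₀ ∈ V_L` has `1, Y₀, …, Y₀^{K+1}` linearly independent.  Then all fibre sums of
the Cayley–Hamilton–Capelli polynomial vanish at every `Y ∈ V_L`: `capRest K Y Z' p = 0` for
`Z' i ∈ V_{e i}`, `L(K+1)(K+2)/2 + d + ∑ e i ≤ 2d`. [folklore] -/
theorem stub_fibreDensity : ∀ (K L n d : ℕ) (A : Fin 2 → Matrix (Fin n) (Fin n) ℂ),
    Submodule.span ℂ {M : Matrix (Fin n) (Fin n) ℂ |
      ∃ w : List (Fin 2), w.length ≤ d ∧ (w.map A).prod = M} = ⊤ →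
    (∀ (T : Finset (List (Fin 2))) (c : List (Fin 2) → ℂ), (∀ w ∈ T, w.length ≤ 2 * d) →
      (∀ B : Fin 2 → Matrix (Fin (K + 1)) (Fin (K + 1)) ℂ, (∑ w ∈ T, c w • (w.map B).prod) = 0) →
      (∑ w ∈ T, c w • (w.map A).prod) = 0) →
    (∃ Y₀ ∈ Masquerade.wordSpan A L, LinearIndependent ℂ (fun j : Fin (K + 2) => Y₀ ^ (j : ℕ))) →
    ∀ (e : Fin K → ℕ), L * ((K + 1) * (K + 2) / 2) + d + ∑ i, e i ≤ 2 * d →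
    ∀ Y ∈ Masquerade.wordSpan A L, ∀ (Z' : Fin K → Matrix (Fin n) (Fin n) ℂ),
    (∀ i, Z' i ∈ Masquerade.wordSpan A (e i)) →
    ∀ p : Fin (K + 2), Masquerade.capRest K Y Z' p = 0 := by
  intro K L n d A hspan hmasq hY₀ e he Y hY Z' hZ' p
  obtain ⟨Y₀, hY₀, hind⟩ := hY₀
  have hX : ∀ M : Matrix (Fin n) (Fin n) ℂ, M ∈ wordSpan A d := fun M => by
    change M ∈ Submodule.span ℂ _
    rw [hspan]
    exact Submodule.mem_top
  refine capRest_eq_zero_of_pencil hind (fun u M => ?_) p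
  refine capPow_eq_zero_of_window hmasq (L := L) (e := Fin.cons d e) ?_
    (Submodule.add_mem _ hY (Submodule.smul_mem _ u hY₀)) ?_
  · rw [Fin.sum_univ_succ]
    simp only [Fin.cons_zero, Fin.cons_succ]
    have h2 : (K + 1) * (K + 1 + 1) / 2 = (K + 1) * (K + 2) / 2 := rfl
    rw [h2]
    linarith
  · refine Fin.cases ?_ fun i => ?_
    · simpa using hX M
    · simpa using hZ' i

end Summit.MatrixMultiplication.MatrixMultiplication.Theorems.TightWindows
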